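import Literature.AnabelianGeometry.AbsoluteAnabelian.AbsTopIII.CuspidalCyclotome
import HarnessLib

/-!
# [AbsTopIII] Prop. 1.4 (ii): the exactness half `I_x · [N, Δ]⁻ = N` is pure group theory

Mochizuki, *Topics in Absolute Anabelian Geometry III*, §1, Prop. 1.4 (ii), manuscript p. 31 (lit key
`paper:url-5493eb38cbb7`): "we have a natural exact sequence of profinite groups
`1 → I_x → Δ^{c-cn}_{U_x} → Δ_X → 1`".  The tree types this display (`CurveModel.lean`,
`IsCuspidallyCentralExtension q I_x`) as the conjunction of

* `inf_eq_bot : I_x ⊓ [N, Δ]⁻ = ⊥` (`I_x → Δ^{c-cn}_{U_x}` is injective), and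
* `sup_eq : I_x ⊔ [N, Δ]⁻ = N` (its image is all of `Ker(Δ^{c-cn}_{U_x} ↠ Δ_X)`),

where `N = Ker(Π_{U_x} ↠ Π_X) ∩ Δ_{U_x}` (`cuspidalKernel`) and `[N, Δ]⁻` is the closed commutator
(`cuspidallyCentralModulus`), and records the named fact `CurveModel.Prop_1_4_ii` (FACT-LIST F-0341)
relative to a model `M : CurveModel`.

This PROOF-ONLY companion file shows that the SECOND clause is a theorem of profinite group theory
for every extension, every homomorphism `q` and every RATIONAL cusp `x` whose inertia group normally
topologically generates `N` (the hypotheses of `Prop_1_4_ii`): for `g = δ d ∈ Π = Δ · D_x` and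
`i ∈ I_x` one has `g i g⁻¹ = [δ, d i d⁻¹] · (d i d⁻¹) ∈ [Δ, N] · I_x`, so `I_x · [N, Δ]⁻` is a closed
normal subgroup containing `I_x`, hence contains `N`.  Consequently the content of the named fact
`Prop_1_4_ii` is EXACTLY the injectivity clause `I_x ∩ [N, Δ]⁻ = 1`
(`CurveModel.prop_1_4_ii_iff_inf_eq_bot`), which is genuinely geometric (it fails in finite toy
models, see the schema witnesses of this directory).  No new facts; nothing here bears on
[IUTchIII] Cor. 3.12.
-/

noncomputable section

open scoped Pointwise

universe u

namespace Literature.AnabelianGeometry.AbsoluteAnabelian.AbsTopIII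

variable {E F : FundamentalExtension.{u}} (q : E ⟶ F) (C : E.CuspidalData) (x : C.Cusp)

/-- For a RATIONAL cusp `x` (its decomposition group surjects onto `G`), every `Π`-conjugate of an
element of `I_x` lies in `I_x · [N, Δ]⁻` as soon as `I_x ≤ N`: writing `g = δ d` with `δ ∈ Δ`,
`d ∈ D_x`, `g i g⁻¹ = [δ, d i d⁻¹] · (d i d⁻¹)` with `d i d⁻¹ ∈ D_x ∩ Δ = I_x`.
[cite: MochizukiAbsTopIII2015, Prop 1.4 (ii) p.31] -/
theorem conj_mem_Icusp_sup_cuspidallyCentralModulus (hx : C.IsRational x)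
    (hI : C.Icusp x ≤ cuspidalKernel q) {i : E.arith} (hi : i ∈ C.Icusp x) (g : E.arith) :
    g * i * g⁻¹ ∈ C.Icusp x ⊔ cuspidallyCentralModulus q := by
  obtain ⟨d, hd, hdg⟩ := hx (Set.mem_univ (E.aug g))
  have hδ : g * d⁻¹ ∈ E.geom := by
    rw [FundamentalExtension.mem_geom, map_mul, map_inv, hdg, mul_inv_cancel]
  have hjD : d * i * d⁻¹ ∈ C.Dcusp x :=
    (C.Dcusp x).mul_mem ((C.Dcusp x).mul_mem hd (C.Icusp_le_Dcusp x hi)) ((C.Dcusp x).inv_mem hd)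
  have hjΔ : d * i * d⁻¹ ∈ E.geom := E.normal_geom.conj_mem i (C.Icusp_le_geom x hi) d
  have hj : d * i * d⁻¹ ∈ C.Icusp x := by
    rw [C.Icusp_eq x]
    exact ⟨hjD, hjΔ⟩
  have hcomm : g * d⁻¹ * (d * i * d⁻¹) * (g * d⁻¹)⁻¹ * (d * i * d⁻¹)⁻¹ ∈
      cuspidallyCentralModulus q := by
    have hmem := Subgroup.commutator_mem_commutator hδ (hI hj)
    rw [commutatorElement_def, Subgroup.commutator_comm] at hmem
    unfold cuspidallyCentralModulus
    exact Subgroup.le_topologicalClosure _ hmem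
  have hrw : g * i * g⁻¹ = g * d⁻¹ * (d * i * d⁻¹) * (g * d⁻¹)⁻¹ * (d * i * d⁻¹)⁻¹ * (d * i * d⁻¹) := by
    group
  rw [hrw, sup_comm]
  exact Subgroup.mul_mem_sup hcomm hj

/-- Under the hypotheses of `Prop_1_4_ii` at a cusp (`x` rational, `N` the closed normal closure of
`I_x`), the subgroup `I_x · [N, Δ]⁻` is normal in `Π_{U_x}`.
[cite: MochizukiAbsTopIII2015, Prop 1.4 (ii) p.31] -/
theorem normal_Icusp_sup_cuspidallyCentralModulus (hx : C.IsRational x)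
    (hI : C.Icusp x ≤ cuspidalKernel q) :
    (C.Icusp x ⊔ cuspidallyCentralModulus q).Normal := by
  refine ⟨fun n hn g => ?_⟩
  have hn' : n ∈ ((C.Icusp x : Set E.arith) * (cuspidallyCentralModulus q : Set E.arith)) := by
    rw [← Subgroup.mul_normal]
    exact hn
  obtain ⟨i, hi, m, hm, rfl⟩ := Set.mem_mul.mp hn'
  have hsplit : g * (i * m) * g⁻¹ = (g * i * g⁻¹) * (g * m * g⁻¹) := by group
  rw [hsplit]
  exact Subgroup.mul_mem _ (conj_mem_Icusp_sup_cuspidallyCentralModulus q C x hx hI hi g)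
    (Subgroup.mem_sup_right ((cuspidallyCentralModulus_normal q).conj_mem m hm g))

/-- `I_x · [N, Δ]⁻` is closed (a product of two compact subsets of the profinite group `Π`).
[cite: MochizukiAbsTopIII2015, Prop 1.4 (ii) p.31] -/
theorem isClosed_Icusp_sup_cuspidallyCentralModulus :
    IsClosed ((C.Icusp x ⊔ cuspidallyCentralModulus q : Subgroup E.arith) : Set E.arith) := by
  rw [Subgroup.mul_normal]
  exact ((C.isClosed_Icusp x).isCompact.mul
    (Subgroup.isClosed_topologicalClosure _).isCompact).isClosed

/-- **The exactness clause of Prop. 1.4 (ii) is automatic**: for a rational cusp `x` with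
`N = Ker(Π_{U_x} ↠ Π_X) ∩ Δ` equal to the closed normal closure of `I_x`, one has
`I_x · [N, Δ]⁻ = N`, i.e. `I_x` maps ONTO `Ker(Δ^{c-cn}_{U_x} ↠ Δ_X)` — for every extension of
profinite groups, with no geometric input. [cite: MochizukiAbsTopIII2015, Prop 1.4 (ii) p.31] -/
theorem Icusp_sup_cuspidallyCentralModulus_eq (hx : C.IsRational x)
    (hker : cuspidalKernel q =
      (Subgroup.normalClosure (C.Icusp x : Set E.arith)).topologicalClosure) :
    C.Icusp x ⊔ cuspidallyCentralModulus q = cuspidalKernel q := by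
  have hI : C.Icusp x ≤ cuspidalKernel q := by
    rw [hker]
    exact Subgroup.le_normalClosure.trans (Subgroup.le_topologicalClosure _)
  refine le_antisymm (sup_le hI ?_) ?_
  · unfold cuspidallyCentralModulus
    refine Subgroup.topologicalClosure_minimal _ (Subgroup.commutator_le_left _ _) ?_
    rw [hker]
    exact Subgroup.isClosed_topologicalClosure _
  · haveI := normal_Icusp_sup_cuspidallyCentralModulus q C x hx hI
    rw [hker]
    exact Subgroup.topologicalClosure_minimal _
      (Subgroup.normalClosure_le_normal fun i hi => Subgroup.mem_sup_left hi)
      (isClosed_Icusp_sup_cuspidallyCentralModulus q C x)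

/-- Hence, under the hypotheses of `Prop_1_4_ii` at a cusp, the cuspidally-central-extension property
`1 → I_x → Δ^{c-cn}_{U_x} → Δ_X → 1` is EQUIVALENT to its injectivity clause `I_x ∩ [N, Δ]⁻ = 1`.
[cite: MochizukiAbsTopIII2015, Prop 1.4 (ii) p.31] -/
theorem isCuspidallyCentralExtension_iff_inf_eq_bot (hx : C.IsRational x)
    (hker : cuspidalKernel q =
      (Subgroup.normalClosure (C.Icusp x : Set E.arith)).topologicalClosure) :
    IsCuspidallyCentralExtension q (C.Icusp x) ↔
      C.Icusp x ⊓ cuspidallyCentralModulus q = ⊥ :=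
  ⟨fun h => h.inf_eq_bot,
    fun h => ⟨h, Icusp_sup_cuspidallyCentralModulus_eq q C x hx hker⟩⟩

/-- **FACT-LIST F-0341 reduced**: the named fact `CurveModel.Prop_1_4_ii M` (Prop. 1.4 (ii), first
display, relative to a model `M`) is equivalent to its injectivity clause alone — for every cuspidal
quotient `U_x ⊆ X` of scheme-like curves of the model with `X` proper and every rational cusp `x`
generating the cuspidal kernel, `I_x ∩ [N, Δ]⁻ = 1`.  The exactness clause carries no content beyond
group theory. [cite: MochizukiAbsTopIII2015, Prop 1.4 (ii) p.31] -/
theorem CurveModel.prop_1_4_ii_iff_inf_eq_bot (M : CurveModel.{u}) :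
    M.Prop_1_4_ii ↔
      ∀ (Ux X : M.Curve) (h : M.IsCofiniteOpen Ux X), M.IsScheme Ux → M.IsScheme X → M.IsProper X →
        ∀ x : (M.cusps Ux).Cusp, (M.cusps Ux).IsRational x →
          cuspidalKernel (M.res h) =
              (Subgroup.normalClosure ((M.cusps Ux).Icusp x : Set (M.ext Ux).arith)).topologicalClosure →
            (M.cusps Ux).Icusp x ⊓ cuspidallyCentralModulus (M.res h) = ⊥ := by
  refine forall₃_congr fun Ux X h => forall₃_congr fun _ _ _ => forall₃_congr fun x hx hker => ?_
  exact isCuspidallyCentralExtension_iff_inf_eq_bot (M.res h) (M.cusps Ux) x hx hker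

end Literature.AnabelianGeometry.AbsoluteAnabelian.AbsTopIII
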